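import Summits.MatrixMultiplication.OmegaCensus.DominoZpZpCover
import Summits.MatrixMultiplication.OmegaCensus.DominoZ7LineTable6A
import Summits.MatrixMultiplication.OmegaCensus.DominoZ7LineTable6B
import Summits.MatrixMultiplication.OmegaCensus.DominoZ7LineTable6C
import HarnessLib

/-!
# Kernel covers on `ZMod 7 × ZMod 7`: part `6` (A: search tree, soundness, chunks 0–1)

ω-census `pub-omega`, family (b3), seat pub-omega-group gen 20.  Framing: lottery ticket; floor = certified bounds/negative
ranges.  VALUE: the finite kernel computation behind the `ℤ_7 × ℤ_7` domino cell theorems with a part `6` (`DominoZ7Z7Cells.lean`); NOT progress on ω.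

Instances of the generic margin-pruned enumeration `DominoZpZpCover.lean`: per part size `d`, the search tree of the
codes of the UNcertified 1-D multisets (`passTree…`, untrusted), its extensional soundness against the certified table
(`…_sound`, `decide`), the kernel cover computations (`cover_…`, `decide`; normal form (i) chunked), and the assembled
semantic statement `exists_table_entry_7_6` consumed by the cell theorems.  Enumeration sizes (leaves / nodes, exact
Python twin `pub-omega-group-g20/code/emulate.py`): normal form (i) 71 442 / 147 826 in 7 chunks (key `polyBE 2 R % 7`): 16 023, 2 744, 14 063, 8 673, 8 673, 2 744, 18 522 leaves; files A (chunks 0, 1), B (2, 3, 4), C (5, 6, axis forms); B and C both import A only; the assembly `exists_table_entry_7_6` lives in `DominoZ7Z7Cells.lean`.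
-/

namespace Summit.MatrixMultiplication.OmegaCensus

namespace ZpZpDomino

/-- The certified table for part `6` (three files). [folklore] -/
abbrev tableZ7d6 : List (List ℕ × List (ℕ × List ℕ)) := tableZ7d6a ++ tableZ7d6b ++ tableZ7d6c

/-- Search tree of the codes `polyBE 7 c` of the 108 UNcertified multisets `c` of size 6 on `ZMod 7`
(complement of the certified table; 924 multisets in all); untrusted, see `passTreeZ7d6_sound`. [folklore] -/
def passTreeZ7d6 : BTree := BTree.ofList [
  122844, 33972, 19272, 4854, 2802, 450, 156, 456, 3144, 2850, 16926, 5496, 5154, 7890, 17214, 17208, 19902, 19566,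
  19314, 19308, 19320, 19656, 19602, 21960, 21660, 19950, 21666, 22344, 22002, 118356, 37044, 36408, 34308, 34014,
  36078, 36750, 36414, 118050, 117666, 50778, 117714, 118098, 118056, 120738, 120402, 120108, 118680, 120156, 120450,
  120444, 122508, 120786, 120744, 122802, 122550, 151410, 136956, 134862, 134562, 134514, 124950, 134520, 134856,
  134814, 136908, 135150, 134904, 135156, 136920, 136914, 137550, 137250, 137208, 136962, 137214, 137544, 137256,
  139602, 139308, 137592, 151368, 139650, 238056, 156408, 154008, 151662, 151614, 153720, 154056, 154014, 235656,
  235356, 172872, 235650, 236034, 235992, 252546, 252114, 240150, 238386, 240156, 252462, 252210, 271314, 256956,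
  254604, 271656, 271362]

set_option maxHeartbeats 4000000 in
/-- The ONLY fact used about `passTreeZ7d6`: a composition of `6` whose code is unflagged is the key of a table entry
(kernel check over all 924 compositions). [folklore] -/
theorem passTreeZ7d6_sound : soundChk 7 6 passTreeZ7d6 tableZ7d6 = true := by decide +kernel

set_option maxHeartbeats 4000000 in
/-- Kernel cover computation, `p = 7`, `d = 6`, normal form (i), chunk `0` of `7`. [folklore] -/
theorem cover_7_6_nf1_0 : coverNF1 7 6 passTreeZ7d6 2 7 0 = true := by decide +kernel

set_option maxHeartbeats 4000000 in
/-- Kernel cover computation, `p = 7`, `d = 6`, normal form (i), chunk `1` of `7`. [folklore] -/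
theorem cover_7_6_nf1_1 : coverNF1 7 6 passTreeZ7d6 2 7 1 = true := by decide +kernel

end ZpZpDomino

end Summit.MatrixMultiplication.OmegaCensus
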